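import Summits.BirchSwinnertonDyer.Rank1Residual.X2.CongruentLambdaShiftDerived
import Summits.BirchSwinnertonDyer.Rank1Residual.X2.MuVanishingOfFiniteModP
import HarnessLib

/-!
# The `μ`-half of Greenberg–Vatsal's Thm. (1.4) DERIVED: `E₁[p] ≅ E₂[p]` and `μ(E₁) = 0` ⇒ `μ(E₂) = 0`
# (good ordinary odd `p`), and the full algebraic transfer `(μ, λ + Σδ)` of route G

HONEST FRAMING (BSD rank-`≤ 1` residual cell `b2b-bsdres`, home
`run/shared/lean/b2b/bsd-rank1-residual/`, unit `b2b-bsdres-eisenstein-p2`, class X2; research route,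
no claim beyond stated classes; nothing booked here; labels unchanged): the cell deletes the
COMBINATION-SHAPED residual classes of the rank-`≤ 1` BSD formula from PUBLISHED theorems only and
TYPES the construction-shaped ones; this is not "finishing BSD". Theorems only (no definition, no
named fact, nothing asserted). Greenberg–Vatsal 2000 p. 27: "As a consequence, we see that if
`μ_{E₁} = 0`, then `μ_{E₂} = 0` and `λ_{E₂,Σ₀} = λ_{E₁,Σ₀}`." The `λ`-clause is
`CongruentLambdaShiftDerived.lambda_add_sum_delta_eq_of_torsionIso` (with `μ = 0` for BOTH curves as
a hypothesis, as in route G's typed `CongruentLambdaShift`); this file derives the `μ`-clause, so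
that `μ(E₂) = 0` is no longer a hypothesis:

* `finite_modN_characterModule_of_finite_torsionBy` (algebra): `S[p]` finite ⇒ `Hom(S, ℚ/ℤ)/p`
  finite (restriction `Hom(S, ℚ/ℤ)/p ↪ Hom(S[p], ℚ/ℤ)` is injective: a character killing `S[p]` is
  `p` times a character, `ℚ/ℤ` being injective — the tree's `natCard_modN_characterModule_le`
  argument, as a finiteness statement);
* **`mu_eq_zero_of_torsionIso_of_facts`**: `E₁, E₂/ℚ` globally minimal, `p` odd good ordinary for
  both, `κ` cyclotomic with topological generator `γ`, `Σ₀ ∌ p` containing the bad primes of both,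
  `E₁[p] ≅ E₂[p]` (`TorsionIso`), dual data `D₁`, `D₂` f.g. and `Λ`-torsion (Kato), `μ(D₁.X) = 0`
  ⇒ `μ(D₂.X) = 0`. Chain: `#(S^{Σ₀}_{E₁} ⊓ H¹[p]) = p^{λ₁ + Σδ₁}` (gen 11 §1) `= #(S^{Σ₀}_{E₂} ⊓ H¹[p])`
  (kernel transfer) `= #Sel^{Σ₀}_{E₂}[p]` (GV p. 26), so `Sel^{Σ₀}_{E₂}[p]` is finite, so
  `X^{Σ₀}_{E₂}/p` is finite (Pontryagin), so `μ(X^{Σ₀}_{E₂}) = 0` (`muInvariant_eq_zero_of_finite_modN`,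
  GV Prop. (2.8) `μ`-half), so `μ(E₂) = μ(X^{Σ₀}_{E₂}) = 0` (GV (7), `μ`-clause);
* **`mu_eq_zero_and_lambda_add_sum_delta_eq_of_torsionIso`** — both clauses together;
* **`algebraicInvariants_transfer_of_facts`** — `CongruentLambdaShift` form with `μ(E₂) = 0` moved
  from hypothesis to conclusion: `μ(D₂.X) = 0 ∧ λ(D₁.X) = λ(D₂.X) + Σ_{v∈Σ₀} (δ₂ − δ₁)`.

Conditional (hypotheses `hGV`, `hA`, `hB`) on the same three PRINTED statements as
`CongruentLambdaShiftDerived`: GV p. 26 / Greenberg Props. 2.2–2.4 (p221999), GV (7) (p224793),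
GV p. 8 / Prop. (2.5) (p224839).

References: R. Greenberg, V. Vatsal, Invent. Math. 142 (2000), Thm. (1.4), §2 Prop. (2.8), pp. 26–27.
-/

noncomputable section

open scoped Classical AddSubgroup

universe u

namespace Summit.BirchSwinnertonDyer.Rank1Residual.X2.MuTransferDerived

open NumberField IsDedekindDomain Field Literature.NumberTheory.GaloisRepresentations
  Literature.NumberTheory.EllipticCurves Literature.NumberTheory.EllipticCurves.GreenbergSelmer
  Literature.NumberTheory.EllipticCurves.GreenbergVatsal2000
  Summit.BirchSwinnertonDyer.Rank1Residual.X2.GreenbergVatsalTorsion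
  Summit.BirchSwinnertonDyer.Rank1Residual.X2.GreenbergVatsalReductionDatum
  Summit.BirchSwinnertonDyer.Rank1Residual.X2.GreenbergVatsalTransferCurve
  Summit.BirchSwinnertonDyer.Rank1Residual.X2.NonPrimitiveSelmerGVEquality
  Summit.BirchSwinnertonDyer.Rank1Residual.X2.NonPrimitiveSelmerDual
  Summit.BirchSwinnertonDyer.Rank1Residual.X2.NonPrimitiveSelmerTorsionCard
  Summit.BirchSwinnertonDyer.Rank1Residual.X2.CongruentLambdaShiftDerived
  Summit.BirchSwinnertonDyer.Rank1Residual.X2.MuVanishingOfFiniteModP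

open WeierstrassCurve (minimalDiscriminantInt)

/-! ## §1. Algebra: `S[p]` finite ⇒ `Hom(S, ℚ/ℤ)/p` finite -/

section Algebra

variable (p : ℕ) {S : Type*} [AddCommGroup S]

/-- **`S[p]` finite ⇒ `Hom(S, ℚ/ℤ)/p` finite**: the restriction `Hom(S, ℚ/ℤ)/p → Hom(S[p], ℚ/ℤ)` is
injective (a character `χ` killing `S[p]` factors through `S/S[p] ≅ pS` and the resulting character
of `pS` extends to `S`, so `χ = p·ψ`; Mathlib `CharacterModule.dual_surjective_of_injective`) and
`Hom(S[p], ℚ/ℤ)` is finite. The injectivity is the argument of the tree's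
`ZpCorank.natCard_modN_characterModule_le`, restated as a finiteness transfer. [folklore] -/
theorem finite_modN_characterModule_of_finite_torsionBy [Finite (S[(p : ℤ)])] :
    Finite (ModN (CharacterModule S) p) := by
  haveI : Finite (CharacterModule (S[(p : ℤ)])) :=
    PontryaginCard.finite_characterModule_of_finite _
  -- the restriction `r : Hom(S, ℚ/ℤ)/p → Hom(S[p], ℚ/ℤ)`
  let r : ModN (CharacterModule S) p →+ CharacterModule (S[(p : ℤ)]) :=
    ModN.liftEquiv.symm
      ⟨(CharacterModule.dual ((S[(p : ℤ)]).subtype.toIntLinearMap)).toAddMonoidHom, fun χ ↦ by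
        refine AddMonoidHom.ext fun b ↦ ?_
        show p • χ (b : S) = 0
        rw [← map_nsmul, ← AddSubgroupClass.coe_nsmul, AddSubgroup.torsionBy.nsmul b,
          ZeroMemClass.coe_zero, map_zero]⟩
  have hr : ∀ (χ : CharacterModule S) (b : S[(p : ℤ)]), r (ModN.mkQ p χ) b = χ b := fun _ _ ↦ rfl
  refine Finite.of_injective r ?_
  rw [injective_iff_map_eq_zero]
  intro q hq
  obtain ⟨χ, rfl⟩ := Submodule.mkQ_surjective _ q
  change r (ModN.mkQ p χ) = 0 at hq
  have hχ : ∀ b : S, p • b = 0 → χ b = 0 := fun b hb ↦ by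
    rw [← hr χ ⟨b, AddSubgroup.torsionBy.nsmul_iff.mpr hb⟩, hq]
    rfl
  let m : S →+ S := nsmulAddMonoidHom p
  have hm : ∀ b, m b = p • b := fun _ ↦ rfl
  have hker : m.rangeRestrict.ker ≤ χ.ker := fun b hb ↦ by
    rw [AddMonoidHom.mem_ker] at hb ⊢
    exact hχ b (by rw [← hm]; exact congrArg (fun z : m.range ↦ (z : S)) hb)
  let χ' : m.range →+ AddCircle (1 : ℚ) :=
    m.rangeRestrict.liftOfSurjective (AddMonoidHom.rangeRestrict_surjective m) ⟨χ, hker⟩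
  have hχ' : ∀ b, χ' (m.rangeRestrict b) = χ b := fun b ↦
    AddMonoidHom.liftOfRightInverse_comp_apply _ _ _ _ b
  obtain ⟨ψ, hψ⟩ := CharacterModule.dual_surjective_of_injective
    (m.range.subtype.toIntLinearMap) (fun a b hab ↦ Subtype.ext hab) χ'
  have hψ' : ∀ g : m.range, ψ g = χ' g := fun g ↦ by
    have := DFunLike.congr_fun hψ g
    rw [CharacterModule.dual_apply] at this
    exact this
  change ModN.mkQ p χ = 0
  rw [ZpCorank.modN_mkQ_eq_zero_iff]
  refine ⟨ψ, ?_⟩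
  rw [LinearMap.lsmul_apply]
  refine CharacterModule.ext (A := S) fun b ↦ ?_
  change (p : ℤ) • ψ b = χ b
  rw [← hχ' b, ← hψ', ← map_zsmul ψ]
  congr 1
  rw [AddMonoidHom.coe_rangeRestrict, hm, natCast_zsmul]

end Algebra

/-! ## §2. `μ(E₁) = 0 ⇒ μ(E₂) = 0` for `E₁[p] ≅ E₂[p]` -/

section MuTransfer

variable (W₁ W₂ : WeierstrassCurve ℚ) [W₁.IsElliptic] [W₁.IsGloballyMinimal] [W₂.IsElliptic]
  [W₂.IsGloballyMinimal] {p : ℕ} [hp : Fact p.Prime] {κ : ZpExtension ℚ p}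
  {γ : absoluteGaloisGroup ℚ} (S₀ : Finset (HeightOneSpectrum (𝓞 ℚ)))

/-- **The `μ`-half of GV Thm. (1.4), derived: `E₁[p] ≅ E₂[p]`, `μ(E₁) = 0` ⇒ `μ(E₂) = 0`.** `E₁, E₂/ℚ`
globally minimal, `p` odd and good ordinary for both, `κ` cyclotomic with topological generator
`γ`, `Σ₀ ∌ p` containing the bad primes of both, `TorsionIso W₁ W₂ p`, dual data `D₁`, `D₂` finitely
generated and `Λ`-torsion (the cotorsion hypothesis of GV §2, Kato), `μ(D₁.X) = 0`. Then
`μ(D₂.X) = 0` (GV p. 27: "if `μ_{E₁} = 0`, then `μ_{E₂} = 0`"): `Sel^{Σ₀}_{E₂}[p]` is finite since its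
order is `#(S^{Σ₀}_{E₁} ⊓ H¹[p]) = p^{λ₁ + Σδ₁}` by the kernel transfer, hence `X^{Σ₀}_{E₂}/p` is
finite, hence `μ(X^{Σ₀}_{E₂}) = 0` (GV Prop. (2.8)), hence `μ(E₂) = 0` (GV (7), `μ`-clause).
[cite: GreenbergVatsal2000, Thm. (1.4), §2 Prop. (2.8) and pp. 26–27] -/
theorem mu_eq_zero_of_torsionIso_of_facts (hGV : imKummer_ge_greenbergCondition_at_p)
    (hA : lambda_nonPrimitive_eq_add_sum_delta) (hB : divisible_nonPrimitiveSelmerInfty_of_mu_eq_zero)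
    (hp2 : p ≠ 2) (hgood₁ : W₁.HasGoodReductionAtPrime p) (hord₁ : ¬ (p : ℤ) ∣ W₁.frobeniusTrace p)
    (hgood₂ : W₂.HasGoodReductionAtPrime p) (hord₂ : ¬ (p : ℤ) ∣ W₂.frobeniusTrace p)
    (hκ : κ.IsCyclotomic) (hγ : κ.IsTopGenerator γ)
    (hS₀ : ∀ v ∈ S₀, ((p : ℕ) : 𝓞 ℚ) ∉ v.asIdeal)
    (hS₁ : ∀ v : HeightOneSpectrum (𝓞 ℚ), v ∉ S₀ → ((p : ℕ) : 𝓞 ℚ) ∉ v.asIdeal →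
      W₁.HasGoodReductionAt v)
    (hS₂ : ∀ v : HeightOneSpectrum (𝓞 ℚ), v ∉ S₀ → ((p : ℕ) : 𝓞 ℚ) ∉ v.asIdeal →
      W₂.HasGoodReductionAt v)
    (hiso : X1.CongruenceTransfer.TorsionIso W₁ W₂ p)
    (D₁ : W₁.SelmerDualData κ γ) (D₂ : W₂.SelmerDualData κ γ)
    [Module.Finite (IwasawaAlgebra p) D₁.X] [Module.Finite (IwasawaAlgebra p) D₂.X]
    (hX₁ : D₁.IsTorsion) (hX₂ : D₂.IsTorsion) (hμ₁ : D₁.mu = 0) : D₂.mu = 0 := by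
  have hΔ₂ := W₂.not_dvd_minimalDiscriminantInt_of_hasGoodReductionAtPrime' p hgood₂
  -- `#(S^{Σ₀}_{E₂} ⊓ H¹[p]) = p^{λ₁ + Σδ₁} ≠ 0`
  have h₁ := natCard_gvSelmerInfty_inf_torsionBy_eq_pow W₁ S₀ hGV hA hB hp2 hgood₁ hord₁ hκ hγ hS₀
    hS₁ D₁ hX₁ hμ₁ (W₁.not_dvd_minimalDiscriminantInt_of_hasGoodReductionAtPrime' p hgood₁)
  have ht := natCard_gvSelmerInfty_inf_torsion_eq_of_torsionIso W₁ W₂ κ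
    (↑S₀ : Set (HeightOneSpectrum (𝓞 ℚ))) hp2 hgood₁ hord₁ hgood₂ hord₂ hκ hS₁ hS₂ hiso
  have hbridge := natCard_torsionBy_nonPrimitiveSelmerInfty_eq W₂ p κ
    (↑S₀ : Set (HeightOneSpectrum (𝓞 ℚ))) hGV hp2 hΔ₂ hord₂ hκ hS₀ hS₂
  have hne : Nat.card ((nonPrimitiveSelmerInfty W₂ κ
      (↑S₀ : Set (HeightOneSpectrum (𝓞 ℚ))))[(p : ℤ)]) ≠ 0 := by
    rw [hbridge, ← ht, h₁]
    exact pow_ne_zero _ hp.out.ne_zero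
  haveI : Finite ((nonPrimitiveSelmerInfty W₂ κ (↑S₀ : Set (HeightOneSpectrum (𝓞 ℚ))))[(p : ℤ)]) :=
    Nat.finite_of_card_ne_zero hne
  -- the dual `X^{Σ₀}_{E₂}` and GV (7)
  set DS := nonPrimitiveDualData W₂ κ (↑S₀ : Set (HeightOneSpectrum (𝓞 ℚ))) hγ with hDS
  obtain ⟨hfg, htors, hmu, -⟩ := hA W₂ p hp2 hgood₂ hord₂ κ hκ γ hγ S₀ hS₀ D₂ DS hX₂
  haveI := hfg
  -- `X^{Σ₀}_{E₂}/p` is finite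
  haveI : Finite (ModN (CharacterModule
      (nonPrimitiveSelmerInfty W₂ κ (↑S₀ : Set (HeightOneSpectrum (𝓞 ℚ))))) p) :=
    finite_modN_characterModule_of_finite_torsionBy p
  have hfin : Finite (ModN DS.X p) :=
    Finite.of_equiv _ (modNEquiv (toDualEquiv W₂ κ _ DS) p).symm.toEquiv
  -- GV Prop. (2.8), `μ`-half, and (7), `μ`-clause
  have hμS : muInvariant p DS.X = 0 := muInvariant_eq_zero_of_finite_modN' p DS.X htors hfin
  change muInvariant p D₂.X = 0
  rw [← hmu, hμS]

/-- **GV Thm. (1.4)'s algebraic transfer, both clauses**: under the hypotheses of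
`mu_eq_zero_of_torsionIso_of_facts` (`μ(E₁) = 0` only), `μ(E₂) = 0` AND
`λ(E₁) + Σ_{v∈Σ₀} δ_{E₁}^{(v)} = λ(E₂) + Σ_{v∈Σ₀} δ_{E₂}^{(v)}`.
[cite: GreenbergVatsal2000, Thm. (1.4) and p. 27] -/
theorem mu_eq_zero_and_lambda_add_sum_delta_eq_of_torsionIso
    (hGV : imKummer_ge_greenbergCondition_at_p)
    (hA : lambda_nonPrimitive_eq_add_sum_delta) (hB : divisible_nonPrimitiveSelmerInfty_of_mu_eq_zero)
    (hp2 : p ≠ 2) (hgood₁ : W₁.HasGoodReductionAtPrime p) (hord₁ : ¬ (p : ℤ) ∣ W₁.frobeniusTrace p)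
    (hgood₂ : W₂.HasGoodReductionAtPrime p) (hord₂ : ¬ (p : ℤ) ∣ W₂.frobeniusTrace p)
    (hκ : κ.IsCyclotomic) (hγ : κ.IsTopGenerator γ)
    (hS₀ : ∀ v ∈ S₀, ((p : ℕ) : 𝓞 ℚ) ∉ v.asIdeal)
    (hS₁ : ∀ v : HeightOneSpectrum (𝓞 ℚ), v ∉ S₀ → ((p : ℕ) : 𝓞 ℚ) ∉ v.asIdeal →
      W₁.HasGoodReductionAt v)
    (hS₂ : ∀ v : HeightOneSpectrum (𝓞 ℚ), v ∉ S₀ → ((p : ℕ) : 𝓞 ℚ) ∉ v.asIdeal →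
      W₂.HasGoodReductionAt v)
    (hiso : X1.CongruenceTransfer.TorsionIso W₁ W₂ p)
    (D₁ : W₁.SelmerDualData κ γ) (D₂ : W₂.SelmerDualData κ γ)
    [Module.Finite (IwasawaAlgebra p) D₁.X] [Module.Finite (IwasawaAlgebra p) D₂.X]
    (hX₁ : D₁.IsTorsion) (hX₂ : D₂.IsTorsion) (hμ₁ : D₁.mu = 0) :
    D₂.mu = 0 ∧ lambdaInvariant p D₁.X + ∑ v ∈ S₀, delta W₁ p v =
      lambdaInvariant p D₂.X + ∑ v ∈ S₀, delta W₂ p v := by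
  have hμ₂ := mu_eq_zero_of_torsionIso_of_facts W₁ W₂ S₀ hGV hA hB hp2 hgood₁ hord₁ hgood₂ hord₂ hκ
    hγ hS₀ hS₁ hS₂ hiso D₁ D₂ hX₁ hX₂ hμ₁
  exact ⟨hμ₂, lambda_add_sum_delta_eq_of_torsionIso W₁ W₂ S₀ hGV hA hB hp2 hgood₁ hord₁ hgood₂
    hord₂ hκ hγ hS₀ hS₁ hS₂ hiso D₁ D₂ hX₁ hX₂ hμ₁ hμ₂⟩

end MuTransfer

/-! ## §3. The transfer in `CongruentLambdaShift` shape with `μ(E₂) = 0` as a CONCLUSION -/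

section Shape

variable (W₁ W₂ : WeierstrassCurve ℚ) [W₁.IsElliptic] [W₁.IsGloballyMinimal] [W₂.IsElliptic]
  [W₂.IsGloballyMinimal] (p : ℕ) [hp : Fact p.Prime] (S₀ : Finset (HeightOneSpectrum (𝓞 ℚ)))

/-- **Route G's algebraic transfer with `μ` included**: for `E₁, E₂/ℚ` globally minimal, `p` odd good
ordinary for both, `Σ₀ ∌ p` containing the bad primes of both, IF `E₁[p] ≅ E₂[p]` THEN for the
cyclotomic `ℤ_p`-extension, every topological generator and all f.g. `Λ`-torsion dual data with
`μ(D₁.X) = 0`: `μ(D₂.X) = 0` and `λ(D₁.X) = λ(D₂.X) + Σ_{v∈Σ₀} (δ_{E₂}^{(v)} − δ_{E₁}^{(v)})` — the typed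
`X1.CongruenceTransfer.CongruentLambdaShift` with its hypothesis `D'.mu = 0` turned into a
conclusion. [cite: GreenbergVatsal2000, Thm. (1.4), §2 pp. 26–27] -/
theorem algebraicInvariants_transfer_of_facts (hGV : imKummer_ge_greenbergCondition_at_p)
    (hA : lambda_nonPrimitive_eq_add_sum_delta) (hB : divisible_nonPrimitiveSelmerInfty_of_mu_eq_zero)
    (hp2 : p ≠ 2) (hgood₁ : W₁.HasGoodReductionAtPrime p) (hord₁ : ¬ (p : ℤ) ∣ W₁.frobeniusTrace p)
    (hgood₂ : W₂.HasGoodReductionAtPrime p) (hord₂ : ¬ (p : ℤ) ∣ W₂.frobeniusTrace p)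
    (hS₀ : ∀ v ∈ S₀, ((p : ℕ) : 𝓞 ℚ) ∉ v.asIdeal)
    (hS₁ : ∀ v : HeightOneSpectrum (𝓞 ℚ), v ∉ S₀ → ((p : ℕ) : 𝓞 ℚ) ∉ v.asIdeal →
      W₁.HasGoodReductionAt v)
    (hS₂ : ∀ v : HeightOneSpectrum (𝓞 ℚ), v ∉ S₀ → ((p : ℕ) : 𝓞 ℚ) ∉ v.asIdeal →
      W₂.HasGoodReductionAt v)
    (hiso : X1.CongruenceTransfer.TorsionIso W₁ W₂ p)
    (κ : ZpExtension ℚ p) (γ : absoluteGaloisGroup ℚ) (hκ : κ.IsCyclotomic)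
    (hγ : κ.IsTopGenerator γ) (D₁ : W₁.SelmerDualData κ γ) (D₂ : W₂.SelmerDualData κ γ)
    [Module.Finite (IwasawaAlgebra p) D₁.X] [Module.Finite (IwasawaAlgebra p) D₂.X]
    (hX₁ : D₁.IsTorsion) (hX₂ : D₂.IsTorsion) (hμ₁ : D₁.mu = 0) :
    D₂.mu = 0 ∧ (lambdaInvariant p D₁.X : ℤ) =
      (lambdaInvariant p D₂.X : ℤ) + ∑ v ∈ S₀, ((delta W₂ p v : ℤ) - (delta W₁ p v : ℤ)) := by
  obtain ⟨hμ₂, h⟩ := mu_eq_zero_and_lambda_add_sum_delta_eq_of_torsionIso W₁ W₂ S₀ hGV hA hB hp2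
    hgood₁ hord₁ hgood₂ hord₂ hκ hγ hS₀ hS₁ hS₂ hiso D₁ D₂ hX₁ hX₂ hμ₁
  refine ⟨hμ₂, ?_⟩
  rw [Finset.sum_sub_distrib]
  have h' : ((lambdaInvariant p D₁.X + ∑ v ∈ S₀, delta W₁ p v : ℕ) : ℤ) =
      ((lambdaInvariant p D₂.X + ∑ v ∈ S₀, delta W₂ p v : ℕ) : ℤ) := by rw [h]
  push_cast at h'
  linarith

end Shape

end Summit.BirchSwinnertonDyer.Rank1Residual.X2.MuTransferDerived

end
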